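import Summits.AtomisticToContinuum.HydrodynamicLimit.Theorems.InformationPercolationEnginePercolationClosesChaosDockingOwners
import Literature.MathematicalPhysics.KineticTheory.HardSphereTwoTimePressure
import HarnessLib

/-!
# The minimal LG-side input behind `RevealedDefectStability` (stub S8 of the line `equilibrium-forecast-chain-rule`,
crux `InformationPercolationEngine.PercolationClosesChaos`, stmt-AtomisticToContinuum-15178)

Support file (`--supports stmt-AtomisticToContinuum-15178`) of the registered stub `stub_revealedDefectStability :
RevealedDefectStability` (worker W6 of lead c3, cycle-4 audit `S8.audit.md`). `RevealedDefectStability` (S8, the sixth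
antecedent of the forecast transfer S6) asks that, under the EVOLVED law `LG`, the truncated owned-collision weight of the
(step, cell) units whose exact cross-ratio defect `unitDefect Ψ` oscillates by more than `η` over the revealed-data atom
(`defectOsc Ψ b … > η`) be small once the velocity bin width `b` is small. The audit splits it into

* an LG-SIDE ITEM, typed here as `RoughCollisionRare`: the truncated unit average of the normalised number `roughOwnedCount` of
  owned ordered contact pairs of a unit that are ROUGH — `g`-GRAZING (`|(v⁻ − w⁻)·ω| < g`: the impact direction `ω ∥ v⁺ − v⁻` is
  not resolved by the binned kick), or with a FAST participant (pre-collisional speed `> V`: no modulus of continuity of `Ψ`),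
  or joining two start-cell populations that are NOT `TamePair s₀ E₀` at the step start (COLD pair — mean relative speed `< s₀`,
  the flux normalisation `pairPair 1` of the cross-ratio is then unstable under the binning — or HOT population — per-capita
  kinetic energy `> E₀`, fast members may dominate the flux) — has `LG`-expectation `≤ δ`, for thresholds `(g, V, s₀, E₀)` the
  item may choose after the kinetic scale `c` (shape `∀ T δ ∃ c₀ ∀ c ≥ c₀ ∃ g V s₀ E₀ ∃ N₀ ∀ N ≥ N₀`, the weakest the reduction
  consumes; `roughOwnedCount ≤ ownedCount`, `roughOwnedCount_le_ownedCount`). Content by channel: grazing = no concentration of the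
  two-particle law of the evolved gas at grazing contacts (flux share of `|u·ω| < g` is `g²/|u|²` per collision under chaos;
  NEW, not implied by `CollisionMomentBound` 15144, `LocalCountUI`, `CoarseLocalMaxwellianity`, `NoKineticIrregularity`);
  fast = velocity-moment tightness of the collision measure (implied by `CollisionMomentBound` up to the dictionary
  `pairWeight_mul_sum_eq_unitAvg` between collision sums and unit averages, and Markov `#{|v| > V} ≤ Σ|v|²/V²`); untame = the
  local state of the evolved law stays in a compact of `{θ > 0}` at the kinetic-cell scale, collision-weighted (temperature
  floor / energy cap; NOT seen by `CoarseLocalMaxwellianity`, whose Maxwellian has the cell's OWN temperature). The three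
  channels are subadditive in `roughOwnedCount`, so the item may be split by the planner.
* a DETERMINISTIC LEMMA, typed here as `DefectOscDomination` (provable bookkeeping + moduli of continuity, NOT proved in this
  file): for `b ≤ b₀(Ψ, η, g, V, s₀, E₀)` and every good `z`,
  `min(ownedCount, T) · 𝟙{η < defectOsc Ψ b} ≤ M(Ψ, η) · min(roughOwnedCount g V s₀ E₀, T)` unit by unit — from the collision-level
  dictionary of the revealed atom (worker W3: owned collision triples, labels, start cells and binned `(v⁻, v⁺, w⁻)` agree on
  the good part of an atom), `|ω − ω'| ≤ 4√3 b/g` off grazing, the modulus of `Ψ` on `S² × B_{V+1}²`, and the flux-average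
  perturbation bound `|P − P'| ≤ m(√3 b) + 4C(E₀/V' + E₀^{3/2}/V'²)/s₀ + 10√3 C b/s₀` on tame pairs (paper proof: `S8.audit.md` §B).
* the COMPOSITION `revealedDefectStability_of_roughCollisionRare : RoughCollisionRare → DefectOscDomination →
  RevealedDefectStability` (registered headline; quantifier threading, `LG`-a.e. good orbits `ae_mem_good_localGibbsLaw`,
  `lintegral_mono_ae`, `lintegral_const_mul'` — no measurability of the `RevealedDefectStability` integrand is needed).

Also: `roughOwnedCount_nonneg`, `roughOwnedCount_eq_zero_of_not_mem` (box support), `roughOwnedCount_le_ownedCount`.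
-/

noncomputable section

open MeasureTheory Set Filter Topology
open scoped ENNReal BigOperators Classical
open Literature.Analysis.FluidPDE Literature.MathematicalPhysics.KineticTheory
open Literature.MathematicalPhysics.KineticTheory.VelocityBlindPlacement

namespace Summit.AtomisticToContinuum.HydrodynamicLimit.Theorems.EquilibriumForecastLine

/-! ## Rough owned collisions of a unit -/

/-- **TAME pair of step-start populations** `P, Q` (finite sets of sphere labels) of the configuration `w` at thresholds
`(s₀, E₀)`: NOT COLD — the mean relative speed over `P × Q` is at least `s₀` (`s₀ · #P · #Q ≤ Σ_{(i,j) ∈ P × Q} ‖v_i − v_j‖`; diagonal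
terms vanish, so this is the total flux `π⁻¹ n̄² · pairPair 1 (q,q')` of the ordered pairs of distinct members: the normalisation of the
cross-ratio `pairPair Ψ / pairPair 1` is then not small against the bin width) — and NOT HOT — the kinetic energy of each population
is at most `E₀` per capita (so that members faster than `V'` carry a flux share `≤ 2 (E₀/V' + E₀^{3/2}/V'²)/s₀`, uniformly in the
population sizes). An empty population makes the pair tame iff the other energy cap holds. -/
def TamePair (s₀ E₀ : ℝ) {N : ℕ} (w : Phase N) (P Q : Finset (Fin (N + 1))) : Prop :=
  s₀ * ((P.card : ℝ) * (Q.card : ℝ)) ≤ ∑ p ∈ P ×ˢ Q, ‖(w p.1).2 - (w p.2).2‖ ∧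
    ∑ i ∈ P, ‖(w i).2‖ ^ 2 ≤ E₀ * (P.card : ℝ) ∧ ∑ j ∈ Q, ‖(w j).2‖ ^ 2 ≤ E₀ * (Q.card : ℝ)

/-- **ROUGH OWNED COLLISION COUNT of unit `q` at step `k`** at thresholds `(g, V, s₀, E₀)`: the number of ordered contact pairs
`(i, j)` of the step window owned by `q` (`cellMin` of the two start cells `= q`, as in `ownedCount`) whose collision is
`g`-GRAZING (`|⟨v_i⁻ − v_j⁻, ω⟩| < g`, mark `(ω, v_i⁻, v_j⁻) = markOf`), or has a FAST participant (`V < ‖v_i⁻‖` or `V < ‖v_j⁻‖`), or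
whose start-cell populations at the step start are not `TamePair s₀ E₀`; normalised by `n̄ c` like `ownedCount` (so
`0 ≤ roughOwnedCount ≤ ownedCount` on the good set, and `roughOwnedCount = 0` off the box of cells). These are exactly the owned collisions
through which `unitDefect Ψ` may fail to be resolved by the revealed data at small bin width (`DefectOscDomination`). -/
def roughOwnedCount (g V s₀ E₀ c σ : ℝ) (N : ℕ) (Φ : Flow σ N) (k : ℕ) (q : Cell) (z : Phase N) : ℝ :=
  (cellCount c σ N * c)⁻¹ *
    Φ.collisionPairSum (stepWindow c σ N k)
      (fun _ w i j =>
        if cellMin (startCell c σ N Φ k z i) (startCell c σ N Φ k z j) = q ∧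
            (|inner ℝ ((markOf N (hsDiameter σ N) w i j).2.1 - (markOf N (hsDiameter σ N) w i j).2.2)
                  (markOf N (hsDiameter σ N) w i j).1| < g ∨
              V < ‖(markOf N (hsDiameter σ N) w i j).2.1‖ ∨ V < ‖(markOf N (hsDiameter σ N) w i j).2.2‖ ∨
              ¬ TamePair s₀ E₀ (Φ.flow ((k : ℝ) * stepLen c σ N) z)
                  (pop c σ N (Φ.flow ((k : ℝ) * stepLen c σ N) z) (startCell c σ N Φ k z i))
                  (pop c σ N (Φ.flow ((k : ℝ) * stepLen c σ N) z) (startCell c σ N Φ k z j)))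
        then (1 : ℝ) else 0) z

/-! ## The two statements and the composition -/

/-- **`RoughCollisionRare`** — ROUGH OWNED COLLISIONS ARE RARE UNDER THE EVOLVED LAW (the minimal LG-side input behind
`RevealedDefectStability`, worker W6's audit of stub S8; item-class, to be FILED by the planner). For continuous positive profiles
there is `σ₀ > 0` such that for `0 < σ < σ₀`, every flow family, horizon `τ > 0`, truncation level `T > 0` and `δ > 0` there is
`c₀` with: for every kinetic scale `c ≥ c₀` there are thresholds `g, V, s₀, E₀ > 0` (grazing, fast, cold, hot — chosen by the item
AFTER `c`, e.g. `V² ≍ log n̄(c)`) such that for all large `N` the `localGibbsLaw`-expectation of the unit average of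
`min(roughOwnedCount g V s₀ E₀, T)` is at most `δ`. Why plausibly true: under local equilibrium the flux share of `g`-grazing collisions
is `≍ g²/(4θ)`, fast participants are Maxwell-tail rare (and their collision-weighted second moments are what `CollisionMomentBound`
15144 makes tight), and a cold pair / hot population of `≍ n̄(c)` spheres is a large deviation of cost `e^{-n̄ I}` at time `0`; at
positive times it is PROPAGATION of "no grazing concentration of the two-particle law at contact, no kinetic-cell-scale
temperature collapse or energy concentration" for the evolved hard-sphere law — an `N`-uniform a-priori input of the same class as
`LocalCountUI` / `NoKineticIrregularity`, not implied by them (they do not see `ω`, nor a temperature floor). Why it might fail: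
a macroscopic fraction of collision weight in grazing geometry (aligned streams), or kinetic-scale cold/hot pockets, at positive
times. -/
def RoughCollisionRare : Prop :=
  ∀ (a₀ θ₀ : T3 → ℝ) (u₀ : T3 → V3), Continuous a₀ → Continuous θ₀ → Continuous u₀ →
    (∀ x, 0 < a₀ x) → (∀ x, 0 < θ₀ x) →
  ∃ σ₀ : ℝ, 0 < σ₀ ∧ ∀ σ : ℝ, 0 < σ → σ < σ₀ → ∀ Φ : (N : ℕ) → Flow σ N, ∀ τ : ℝ, 0 < τ →
  ∀ T δ : ℝ, 0 < T → 0 < δ →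
  ∃ c₀ : ℝ, 0 < c₀ ∧ ∀ c : ℝ, c₀ ≤ c →
  ∃ g V s₀ E₀ : ℝ, 0 < g ∧ 0 < V ∧ 0 < s₀ ∧ 0 < E₀ ∧ ∃ N₀ : ℕ, ∀ N : ℕ, N₀ ≤ N →
    ∫⁻ z, ENNReal.ofReal (unitAvg c σ N τ fun k q => min (roughOwnedCount g V s₀ E₀ c σ N (Φ N) k q z) T)
      ∂(localGibbsLaw σ a₀ u₀ θ₀ N (Φ N)) ≤ ENNReal.ofReal δ

/-- **`DefectOscDomination`** — THE OSCILLATION LEMMA (deterministic; lemma-class, the future support file of S8): for every bounded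
continuous mark test `Ψ` (bound `C`) and `η > 0` there is `M ≥ 0` (`max(8C/η, 1)` works) such that for all thresholds
`T, g, V, s₀, E₀ > 0` there is a bin width `b₀ > 0` — depending on `Ψ` only through its modulus of continuity on
`S² × B̄_{V'+1} × B̄_{V'+1}`, `V' = V'(V, E₀, s₀, η, C)`, and NOT on `σ, N, Φ, c` — with: for `0 < σ < 1/2`, every `N`, flow, `c > 0`,
`0 < b ≤ b₀`, every GOOD initial datum `z` and every unit `(k, q)`,
`min(ownedCount, T) · 𝟙{η < defectOsc Ψ b} ≤ M · min(roughOwnedCount g V s₀ E₀, T)`.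
Proof on paper (`S8.audit.md` §B): on the good part of the revealed atom of `z` the owned collision triples, their labels, start
cells and binned `(v⁻, v⁺, w⁻)` are common (collision-level dictionary, worker W3), so
`|unitDefect z' − unitDefect z| ≤ 4C · roughOwnedCount z / ownedCount z + 2 m_Ψ(4√3 b/g ∨ √3 b) + 4C(E₀/V' + E₀^{3/2}/V'²)/s₀ + 10√3 C b/s₀`
(non-rough collisions: `ω ∥ v⁺ − v⁻` with `|v⁺ − v⁻| = |⟨v⁻ − w⁻, ω⟩| ≥ g` gives `|ω − ω'| ≤ 4√3 b/g`; tame pairs: the flux average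
`pairPair Ψ / pairPair 1` moves by at most the last three terms); choose `V'` then `b₀` to make the tail `≤ η/2`, and
`η/2 < 4C · rough/owned` gives `min(owned, T) ≤ max(8C/η, 1) · min(rough, T)`. -/
def DefectOscDomination : Prop :=
  ∀ Ψ : V3 × V3 × V3 → ℝ, Continuous Ψ → ∀ C : ℝ, (∀ p, |Ψ p| ≤ C) → ∀ η : ℝ, 0 < η →
  ∃ M : ℝ, 0 ≤ M ∧ ∀ T g V s₀ E₀ : ℝ, 0 < T → 0 < g → 0 < V → 0 < s₀ → 0 < E₀ →
  ∃ b₀ : ℝ, 0 < b₀ ∧ ∀ (σ : ℝ) (N : ℕ) (Φ : Flow σ N) (c b : ℝ), 0 < σ → σ < 2⁻¹ → 0 < c → 0 < b → b ≤ b₀ →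
  ∀ z ∈ Φ.good, ∀ (k : ℕ) (q : Cell),
    min (ownedCount c σ N Φ k q z) T * (if η < defectOsc Ψ b c σ N Φ k q z then 1 else 0) ≤
      M * min (roughOwnedCount g V s₀ E₀ c σ N Φ k q z) T

/-! ## Elementary facts about `roughOwnedCount` -/

section Rough

variable {σ : ℝ} {N : ℕ} (Φ : Flow σ N)

/-- `roughOwnedCount ≥ 0`. [folklore] -/
theorem roughOwnedCount_nonneg {c : ℝ} (hc : 0 ≤ c) (hσ : 0 < σ) (g V s₀ E₀ : ℝ) (k : ℕ) (q : Cell) (z : Phase N) :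
    0 ≤ roughOwnedCount g V s₀ E₀ c σ N Φ k q z := by
  unfold roughOwnedCount
  refine mul_nonneg (inv_nonneg.2 (mul_nonneg ?_ hc)) (collisionPairSum_nonneg fun _ _ _ => by positivity)
  unfold cellCount
  have := meanFreePath_pos hσ N
  positivity

/-- `roughOwnedCount` vanishes off the box of cells (an owned pair has a member starting in `q`). [folklore] -/
theorem roughOwnedCount_eq_zero_of_not_mem {c : ℝ} (h : 0 < c * meanFreePath σ N) (g V s₀ E₀ : ℝ) (k : ℕ) {q : Cell}
    (hq : q ∉ cellBox (c * meanFreePath σ N)) (z : Phase N) : roughOwnedCount g V s₀ E₀ c σ N Φ k q z = 0 := by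
  unfold roughOwnedCount
  have hfun : (fun (_ : ℝ) (w : Phase N) (i j : Fin (N + 1)) =>
      if cellMin (startCell c σ N Φ k z i) (startCell c σ N Φ k z j) = q ∧
          (|inner ℝ ((markOf N (hsDiameter σ N) w i j).2.1 - (markOf N (hsDiameter σ N) w i j).2.2)
                (markOf N (hsDiameter σ N) w i j).1| < g ∨
            V < ‖(markOf N (hsDiameter σ N) w i j).2.1‖ ∨ V < ‖(markOf N (hsDiameter σ N) w i j).2.2‖ ∨
            ¬ TamePair s₀ E₀ (Φ.flow ((k : ℝ) * stepLen c σ N) z)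
                (pop c σ N (Φ.flow ((k : ℝ) * stepLen c σ N) z) (startCell c σ N Φ k z i))
                (pop c σ N (Φ.flow ((k : ℝ) * stepLen c σ N) z) (startCell c σ N Φ k z j)))
      then (1 : ℝ) else 0) = fun _ _ _ _ => (0 : ℝ) := by
    funext s w i j
    rw [if_neg]
    rintro ⟨hi, -⟩
    rcases cellMin_mem_pair (startCell c σ N Φ k z i) (startCell c σ N Φ k z j) with hm | hm
    · rw [hm] at hi
      exact hq (hi ▸ startCell_mem_cellBox h Φ k z i)
    · rw [hm] at hi
      exact hq (hi ▸ startCell_mem_cellBox h Φ k z j)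
  rw [hfun, collisionPairSum_zero_fun, mul_zero]

/-- **`roughOwnedCount ≤ ownedCount`** on the good set (rough owned pairs are owned pairs). [folklore] -/
theorem roughOwnedCount_le_ownedCount {z : Phase N} (hz : z ∈ Φ.good) {c : ℝ} (hc : 0 < c) (hσ : 0 < σ) (g V s₀ E₀ : ℝ)
    (k : ℕ) (q : Cell) : roughOwnedCount g V s₀ E₀ c σ N Φ k q z ≤ ownedCount c σ N Φ k q z := by
  have h0 : 0 ≤ (cellCount c σ N * c)⁻¹ := inv_nonneg.2 (mul_pos (cellCount_pos hc hσ N) hc).le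
  rw [ownedCount_eq_sum Φ hz]
  unfold roughOwnedCount
  rw [collisionPairSum_eq_sum_collTriples Φ hz (stepWindow_subset_Icc c σ N k)]
  refine mul_le_mul_of_nonneg_left (Finset.sum_le_sum fun e _ => ?_) h0
  by_cases hm : cellMin (startCell c σ N Φ k z e.2.1) (startCell c σ N Φ k z e.2.2) = q
  · rw [if_pos hm]
    split_ifs <;> norm_num
  · rw [if_neg hm, if_neg (fun h => hm h.1)]

end Rough

/-- **Registered headline `revealedDefectStability_of_roughCollisionRare`: the LG-side item and the oscillation lemma imply
`RevealedDefectStability`.** Quantifiers: `σ₀ := min(σ₀ of the item, 1/2)`; given `(σ, Φ, τ, Ψ, C, η, δ, T)` take `M` from the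
lemma, `c₀` from the item at `(T, δ/(M+1))`; for `c ≥ c₀` the item's thresholds `(g, V, s₀, E₀)` and `N₀`, then `b₀` from the
lemma; for `0 < b ≤ b₀` and `N ≥ N₀` the unit averages compare pointwise on the good set (`unitAvg_mono`, both families
box-supported: `ownedCount_eq_zero_of_not_mem`, `roughOwnedCount_eq_zero_of_not_mem`), hence `LG`-a.e. (`ae_mem_good_localGibbsLaw`),
and `∫⁻ ofReal(unitAvg …) dLG ≤ ofReal M · ofReal(δ/(M+1)) ≤ ofReal δ` (`lintegral_mono_ae`, `lintegral_const_mul'`). [folklore] -/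
theorem revealedDefectStability_of_roughCollisionRare : RoughCollisionRare → DefectOscDomination → RevealedDefectStability := by
  intro hR hD a₀ θ₀ u₀ ha hθ hu ha0 hθ0
  obtain ⟨σ₀, hσ₀, HR⟩ := hR a₀ θ₀ u₀ ha hθ hu ha0 hθ0
  refine ⟨min σ₀ 2⁻¹, by positivity, ?_⟩
  intro σ hσ hσlt Φ τ hτ Ψ hΨc hΨb η δ T hη hδ hT
  obtain ⟨C, hC⟩ := hΨb
  have hσ₀' : σ < σ₀ := hσlt.trans_le (min_le_left _ _)
  have hhalf : σ < 2⁻¹ := hσlt.trans_le (min_le_right _ _)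
  obtain ⟨M, hM0, HD⟩ := hD Ψ hΨc C hC η hη
  obtain ⟨c₀, hc₀, HRc⟩ := HR σ hσ hσ₀' Φ τ hτ T (δ / (M + 1)) hT (by positivity)
  refine ⟨c₀, hc₀, fun c hc => ?_⟩
  have hc0 : 0 < c := hc₀.trans_le hc
  obtain ⟨g, V, s₀, E₀, hg, hV, hs₀, hE₀, N₀, HRN⟩ := HRc c hc
  obtain ⟨b₀, hb₀, HDb⟩ := HD T g V s₀ E₀ hT hg hV hs₀ hE₀
  refine ⟨b₀, hb₀, fun b hb hbb₀ => ⟨N₀, fun N hN => ?_⟩⟩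
  have hh : 0 < c * meanFreePath σ N := mul_pos hc0 (meanFreePath_pos hσ N)
  -- homogeneity of the unit average (any family: `tsum_mul_left` is unconditional over `ℝ`)
  have hcm : ∀ F : ℕ → Cell → ℝ, unitAvg c σ N τ (fun k q => M * F k q) = M * unitAvg c σ N τ F := by
    intro F
    unfold unitAvg
    simp only [tsum_mul_left, ← Finset.mul_sum]
    ring
  -- pointwise domination of the unit averages on the good set
  have hpt : ∀ z ∈ (Φ N).good,
      unitAvg c σ N τ (fun k q => min (ownedCount c σ N (Φ N) k q z) T *
          (if η < defectOsc Ψ b c σ N (Φ N) k q z then 1 else 0)) ≤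
        M * unitAvg c σ N τ (fun k q => min (roughOwnedCount g V s₀ E₀ c σ N (Φ N) k q z) T) := by
    intro z hz
    rw [← hcm]
    refine unitAvg_mono hh.le (fun k q hq => ?_) (fun k q hq => ?_)
      (fun k q => HDb σ N (Φ N) c b hσ hhalf hc0 hb hbb₀ z hz k q)
    · rw [ownedCount_eq_zero_of_not_mem hh (Φ N) k hq z, min_eq_left hT.le, zero_mul]
    · rw [roughOwnedCount_eq_zero_of_not_mem (Φ N) hh g V s₀ E₀ k hq z, min_eq_left hT.le, mul_zero]
  -- integrate against `LG`, a.e. on the good set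
  have hae : ∀ᵐ z ∂(localGibbsLaw σ a₀ u₀ θ₀ N (Φ N)),
      ENNReal.ofReal (unitAvg c σ N τ (fun k q => min (ownedCount c σ N (Φ N) k q z) T *
          (if η < defectOsc Ψ b c σ N (Φ N) k q z then 1 else 0))) ≤
        ENNReal.ofReal M *
          ENNReal.ofReal (unitAvg c σ N τ (fun k q => min (roughOwnedCount g V s₀ E₀ c σ N (Φ N) k q z) T)) := by
    filter_upwards [ae_mem_good_localGibbsLaw σ a₀ u₀ θ₀ N (Φ N)] with z hz
    rw [← ENNReal.ofReal_mul hM0]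
    exact ENNReal.ofReal_le_ofReal (hpt z hz)
  have hfin : M * (δ / (M + 1)) ≤ δ := by
    rw [mul_div_assoc', div_le_iff₀ (by positivity)]
    nlinarith
  calc ∫⁻ z, ENNReal.ofReal (unitAvg c σ N τ fun k q => min (ownedCount c σ N (Φ N) k q z) T *
          (if η < defectOsc Ψ b c σ N (Φ N) k q z then 1 else 0)) ∂(localGibbsLaw σ a₀ u₀ θ₀ N (Φ N))
      ≤ ∫⁻ z, ENNReal.ofReal M *
          ENNReal.ofReal (unitAvg c σ N τ fun k q => min (roughOwnedCount g V s₀ E₀ c σ N (Φ N) k q z) T)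
            ∂(localGibbsLaw σ a₀ u₀ θ₀ N (Φ N)) := lintegral_mono_ae hae
    _ = ENNReal.ofReal M * ∫⁻ z,
          ENNReal.ofReal (unitAvg c σ N τ fun k q => min (roughOwnedCount g V s₀ E₀ c σ N (Φ N) k q z) T)
            ∂(localGibbsLaw σ a₀ u₀ θ₀ N (Φ N)) := lintegral_const_mul' _ _ ENNReal.ofReal_ne_top
    _ ≤ ENNReal.ofReal M * ENNReal.ofReal (δ / (M + 1)) := by gcongr; exact HRN N hN
    _ = ENNReal.ofReal (M * (δ / (M + 1))) := (ENNReal.ofReal_mul hM0).symm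
    _ ≤ ENNReal.ofReal δ := ENNReal.ofReal_le_ofReal hfin

end Summit.AtomisticToContinuum.HydrodynamicLimit.Theorems.EquilibriumForecastLine

end
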